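import Literature.AnabelianGeometry.AbsoluteAnabelian.HolomorphicEllipticCuspidalization
import Literature.AnabelianGeometry.AbsoluteAnabelian.HolomorphicCoresDeckProofs
import Literature.AnabelianGeometry.AbsoluteAnabelian.AutHolomorphicSpacesProofs

/-!
# [AbsTopIII] Cor 2.7 (b)/(c) — PROOF of sub-node (c).5 `CuspidalTorsionPointsTransport`
# (SUBDAG row Cor-27.c.r15): biholomorphisms transport elliptic cuspidalization diagrams

Proof-only companion (abc-iut cell, seat abc-iut-w5-d140, row Cor-27.c.r15 of
`plan/L4/SUBDAG-AbsTopIII-Cor-27.md`) of `HolomorphicEllipticCuspidalization.lean` (p414370, seat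
abc-iut-L4-t12), which it imports unchanged.  S. Mochizuki, *Topics in Absolute Anabelian Geometry III*,
Cor 2.7 (b) p.59 («elliptic cuspidalization diagrams … one may construct the torsion points … as the
points in the complement of the image of such morphisms `U ↪ E`») and the functoriality clause p.60
l.15–16, in the tautological case of an ISOMORPHISM [cite: MochizukiAbsTopIII2015, Corollary 2.7 (b) p.59].

What is proved (no new definitions of mathematical content; one auxiliary construction `transport`):
* `holAut_map_homeoConj_of_restrict₂`, `isMorphism_ofCharted_of_biholomorphic`: a biholomorphic
  homeomorphism `γ : E ⥲ E'` of spaces charted over `ℂ` is a morphism of the associated Aut-holomorphic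
  spaces (two-space version of `isMorphism_ofCharted_of_mdifferentiable`, `HolomorphicCoresDeckProofs`);
* `EllipticCuspidalizationDiagram.transport`: an elliptic cuspidalization diagram `𝔼 ↩ 𝕌 → 𝔼` of `E`
  composed with `γ` is one of `E'` (every field transported: covering via `IsCoveringMap.homeomorph_comp`,
  morphisms via `IsMorphism.comp`, deck group unchanged, co-holomorphicity via
  `isHolAt_homeomorph_comp_iff`);
* `image_cuspidalTorsionPoints_subset`, and the closing theorem
  **`HolomorphicEllipticCuspidalization.cuspidalTorsionPointsTransport_holds :
  HolomorphicEllipticCuspidalization.CuspidalTorsionPointsTransport`** (FQ type of the sub-node).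
HONEST FRAMING: a formal transport lemma about OUR typing of a refereed statement; typed ≠ proved for
the remaining rows; nothing here bears on the disputed [IUTchIII] Cor. 3.12.
-/

noncomputable section

namespace Literature.AnabelianGeometry.AbsoluteAnabelian

open _root_.TopologicalSpace _root_.Topology _root_.Filter _root_.Set
open scoped _root_.Manifold _root_.ContDiff

universe u

section TwoSpaces

variable {E : Type u} [TopologicalSpace E] [ChartedSpace ℂ E]
  {E' : Type u} [TopologicalSpace E'] [ChartedSpace ℂ E']

/-- A map between open subsets of two spaces charted over `ℂ` whose composite with the inclusions is a
holomorphic map of the ambient spaces is holomorphic (two-space version of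
`mdifferentiable_opens_of_val_eq`). [cite: MochizukiAbsTopIII2015, Definition 2.1 (ii) p.51] -/
theorem mdifferentiable_opens_of_val_eq₂ {U : Opens E} {V : Opens E'} {g : E → E'}
    (hg : MDifferentiable 𝓘(ℂ, ℂ) 𝓘(ℂ, ℂ) g) (e : U → V) (he : ∀ x : U, (e x : E') = g x) :
    MDifferentiable 𝓘(ℂ, ℂ) 𝓘(ℂ, ℂ) e := by
  intro x
  rw [← mdifferentiableAt_subtypeVal_comp_iff]
  have : (Subtype.val ∘ e) = fun x : U => g x := funext fun x => he x
  rw [this, mdifferentiableAt_subtype_iff]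
  exact hg x

/-- **Transport of `Aut^hol` by conjugation along a biholomorphism of two surfaces**: if `e : U ≃ₜ V`
(`U ⊆ E`, `V ⊆ E'` open) is the restriction of a biholomorphic homeomorphism `γ : E ⥲ E'`, conjugation
by `e` carries `Aut^hol(U)` onto `Aut^hol(V)` (two-space version of `holAut_map_homeoConj_of_restrict`).
[cite: MochizukiAbsTopIII2015, Definition 2.1 (ii) p.51] -/
theorem holAut_map_homeoConj_of_restrict₂ (γ : E ≃ₜ E') (hγ : MDifferentiable 𝓘(ℂ, ℂ) 𝓘(ℂ, ℂ) γ)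
    (hγ' : MDifferentiable 𝓘(ℂ, ℂ) 𝓘(ℂ, ℂ) γ.symm) {U : Opens E} {V : Opens E'} (e : U ≃ₜ V)
    (he : ∀ x : U, (e x : E') = γ x) :
    (holAut U).map (homeoConj e).toMonoidHom = holAut V := by
  have he' : ∀ y : V, (e.symm y : E) = γ.symm y := by
    intro y
    apply γ.injective
    rw [γ.apply_symm_apply, ← he, e.apply_symm_apply]
  have hme : MDifferentiable 𝓘(ℂ, ℂ) 𝓘(ℂ, ℂ) e := mdifferentiable_opens_of_val_eq₂ hγ e he
  have hme' : MDifferentiable 𝓘(ℂ, ℂ) 𝓘(ℂ, ℂ) e.symm := mdifferentiable_opens_of_val_eq₂ hγ' e.symm he'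
  ext χ
  rw [Subgroup.mem_map_equiv]
  simp only [mem_holAut_iff]
  constructor
  · rintro ⟨h1, h2⟩
    refine ⟨?_, ?_⟩
    · have : ⇑χ = e ∘ ((homeoConj e).symm χ) ∘ e.symm := by
        ext y; simp [homeoConj]
      rw [this]; exact (hme.comp h1).comp hme'
    · have : ⇑χ.symm = e ∘ ((homeoConj e).symm χ).symm ∘ e.symm := by
        ext y; simp [homeoConj]
      rw [this]; exact (hme.comp h2).comp hme'
  · rintro ⟨h1, h2⟩
    refine ⟨?_, ?_⟩
    · have : ⇑((homeoConj e).symm χ) = e.symm ∘ χ ∘ e := by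
        ext y; simp [homeoConj]
      rw [this]; exact (hme'.comp h1).comp hme
    · have : ⇑((homeoConj e).symm χ).symm = e.symm ∘ χ.symm ∘ e := by
        ext y; simp [homeoConj]
      rw [this]; exact (hme'.comp h2).comp hme

/-- **A biholomorphic homeomorphism `γ : E ⥲ E'` is a morphism of the associated Aut-holomorphic spaces**
(Def 2.1 (ii); two-space version of `isMorphism_ofCharted_of_mdifferentiable`).
[cite: MochizukiAbsTopIII2015, Definition 2.1 (ii) p.51] -/
theorem isMorphism_ofCharted_of_biholomorphic (γ : E ≃ₜ E')
    (hγ : MDifferentiable 𝓘(ℂ, ℂ) 𝓘(ℂ, ℂ) γ) (hγ' : MDifferentiable 𝓘(ℂ, ℂ) 𝓘(ℂ, ℂ) γ.symm) :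
    IsMorphism (AutHolStructure.ofCharted E) (AutHolStructure.ofCharted E') γ where
  isLocalHomeomorph := γ.isLocalHomeomorph
  map_aut_eq := by
    intro U V _ _ e he
    rw [AutHolStructure.ofCharted_aut, AutHolStructure.ofCharted_aut]
    exact holAut_map_homeoConj_of_restrict₂ γ hγ hγ' e he

variable {U : Type u} [TopologicalSpace U]

omit [ChartedSpace ℂ E] [ChartedSpace ℂ E'] in
/-- The deck transformations of `γ ∘ f` are those of `f`, for `γ` a homeomorphism of the base
(injectivity of `γ`). [cite: MochizukiAbsTopIII2015, Corollary 2.7 (b) p.59] -/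
theorem deckGroup_homeomorph_comp (f : U → E) (γ : E ≃ₜ E') : deckGroup (γ ∘ f) = deckGroup f := by
  ext φ
  change (∀ y, γ (f (φ y)) = γ (f y)) ↔ ∀ y, f (φ y) = f y
  exact ⟨fun h y => γ.injective (h y), fun h y => by rw [h y]⟩

/-- Holomorphy at a point is invariant under post-composition with a biholomorphism
(`IsHolAt (γ ∘ f) x ↔ IsHolAt f x`). [cite: MochizukiAbsTopIII2015, Definition 2.1 (ii) p.51] -/
theorem isHolAt_homeomorph_comp_iff [ChartedSpace ℂ U] (γ : E ≃ₜ E')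
    (hγ : MDifferentiable 𝓘(ℂ, ℂ) 𝓘(ℂ, ℂ) γ) (hγ' : MDifferentiable 𝓘(ℂ, ℂ) 𝓘(ℂ, ℂ) γ.symm)
    (f : U → E) (x : U) : IsHolAt (γ ∘ f) x ↔ IsHolAt f x := by
  constructor
  · intro h
    filter_upwards [h] with y hy
    have h2 : MDifferentiableAt 𝓘(ℂ, ℂ) 𝓘(ℂ, ℂ) (γ.symm ∘ (γ ∘ f)) y := (hγ' _).comp y hy
    have heq : (γ.symm ∘ (γ ∘ f)) = f := funext fun z => γ.symm_apply_apply (f z)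
    rwa [heq] at h2
  · intro h
    filter_upwards [h] with y hy
    exact (hγ _).comp y hy

omit [ChartedSpace ℂ E] [ChartedSpace ℂ E'] in
/-- Connected components are respected by a homeomorphism: `cc a = cc b → cc (γ a) = cc (γ b)`.
(bookkeeping) [cite: MochizukiAbsTopIII2015, Corollary 2.7 (b) p.59] -/
theorem connectedComponent_eq_homeomorph (γ : E ≃ₜ E') {a b : E}
    (h : connectedComponent a = connectedComponent b) :
    connectedComponent (γ a) = connectedComponent (γ b) := by
  have hb : b ∈ connectedComponent a := h ▸ mem_connectedComponent
  have hγb : γ b ∈ connectedComponent (γ a) :=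
    (γ.continuous.image_connectedComponent_subset a) ⟨b, hb, rfl⟩
  exact connectedComponent_eq hγb

/-- Co-holomorphicity (`IsCoHolomorphicRS`) is preserved by post-composition with a biholomorphism.
[cite: MochizukiAbsTopIII2015, Corollary 2.7 (b) p.59] -/
theorem isCoHolomorphicRS_homeomorph_comp [ChartedSpace ℂ U] (γ : E ≃ₜ E')
    (hγ : MDifferentiable 𝓘(ℂ, ℂ) 𝓘(ℂ, ℂ) γ) (hγ' : MDifferentiable 𝓘(ℂ, ℂ) 𝓘(ℂ, ℂ) γ.symm)
    {φ₁ φ₂ : U → E} (h : IsCoHolomorphicRS φ₁ φ₂) : IsCoHolomorphicRS (γ ∘ φ₁) (γ ∘ φ₂) := by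
  intro x x' hxx'
  obtain ⟨hcc, hhol⟩ := h x x' hxx'
  refine ⟨connectedComponent_eq_homeomorph γ hcc, ?_⟩
  rw [isHolAt_homeomorph_comp_iff γ hγ hγ' φ₁ x, isHolAt_homeomorph_comp_iff γ hγ hγ' φ₂ x']
  exact hhol

/-- **Transport of an elliptic cuspidalization diagram along a biholomorphism** `γ : E ⥲ E'`
(functoriality of Cor 2.7 (b) in the tautological case of an isomorphism): `𝔼 ↩ 𝕌 → 𝔼` becomes
`𝔼' ↩ 𝕌 → 𝔼'` with the same `𝕌`, `cov' := γ ∘ cov`, `imm' := γ ∘ imm`.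
[cite: MochizukiAbsTopIII2015, Corollary 2.7 (b) p.59] -/
def EllipticCuspidalizationDiagram.transport (D : EllipticCuspidalizationDiagram E) (γ : E ≃ₜ E')
    (hγ : MDifferentiable 𝓘(ℂ, ℂ) 𝓘(ℂ, ℂ) γ) (hγ' : MDifferentiable 𝓘(ℂ, ℂ) 𝓘(ℂ, ℂ) γ.symm) :
    EllipticCuspidalizationDiagram E' where
  U := D.U
  cov := γ ∘ D.cov
  imm := γ ∘ D.imm
  cov_finiteEtale :=
    { isCoveringMap := D.cov_finiteEtale.isCoveringMap.homeomorph_comp γ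
      finite_fibre := fun y => by
        have : (γ ∘ D.cov) ⁻¹' {y} = D.cov ⁻¹' {γ.symm y} := by
          ext u
          simp only [mem_preimage, mem_singleton_iff, Function.comp_apply]
          constructor
          · intro h; rw [← h, γ.symm_apply_apply]
          · intro h; rw [h, γ.apply_symm_apply]
        rw [this]
        exact D.cov_finiteEtale.finite_fibre _ }
  cov_morphism := (isMorphism_ofCharted_of_biholomorphic γ hγ hγ').comp D.cov_morphism
  cov_galois_abelian := by
    have hdeck : deckGroup (γ ∘ D.cov) = deckGroup D.cov := deckGroup_homeomorph_comp D.cov γ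
    obtain ⟨hcomm, htrans⟩ := D.cov_galois_abelian
    refine ⟨fun φ ψ => ?_, fun u u' huu' => ?_⟩
    · have hφ : (φ : D.U ≃ₜ D.U) ∈ deckGroup D.cov := hdeck ▸ φ.2
      have hψ : (ψ : D.U ≃ₜ D.U) ∈ deckGroup D.cov := hdeck ▸ ψ.2
      have h := congrArg Subtype.val (hcomm ⟨φ, hφ⟩ ⟨ψ, hψ⟩)
      exact Subtype.ext h
    · have h' : D.cov u = D.cov u' := γ.injective huu'
      obtain ⟨φ, hφ⟩ := htrans u u' h'
      exact ⟨⟨φ, hdeck.symm ▸ φ.2⟩, hφ⟩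
  imm_openEmbedding := γ.isOpenEmbedding.comp D.imm_openEmbedding
  imm_morphism := (isMorphism_ofCharted_of_biholomorphic γ hγ hγ').comp D.imm_morphism
  imm_cofinite := by
    rw [Set.range_comp, ← Set.image_compl_eq γ.bijective]
    exact D.imm_cofinite.image γ
  coholomorphic := isCoHolomorphicRS_homeomorph_comp γ hγ hγ' D.coholomorphic

/-- The open immersion of the transported diagram has image `γ(image of the original one)`.
[cite: MochizukiAbsTopIII2015, Corollary 2.7 (b) p.59] -/
theorem EllipticCuspidalizationDiagram.range_transport_imm (D : EllipticCuspidalizationDiagram E)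
    (γ : E ≃ₜ E') (hγ : MDifferentiable 𝓘(ℂ, ℂ) 𝓘(ℂ, ℂ) γ)
    (hγ' : MDifferentiable 𝓘(ℂ, ℂ) 𝓘(ℂ, ℂ) γ.symm) :
    Set.range (D.transport γ hγ hγ').imm = γ '' Set.range D.imm :=
  Set.range_comp γ D.imm

/-- A biholomorphism maps cuspidal torsion points INTO cuspidal torsion points (transport the
witnessing diagram). [cite: MochizukiAbsTopIII2015, Corollary 2.7 (b) p.59] -/
theorem image_cuspidalTorsionPoints_subset (γ : E ≃ₜ E') (hγ : MDifferentiable 𝓘(ℂ, ℂ) 𝓘(ℂ, ℂ) γ)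
    (hγ' : MDifferentiable 𝓘(ℂ, ℂ) 𝓘(ℂ, ℂ) γ.symm) :
    γ '' cuspidalTorsionPoints E ⊆ cuspidalTorsionPoints E' := by
  rintro _ ⟨x, ⟨D, hx⟩, rfl⟩
  refine ⟨D.transport γ hγ hγ', fun hmem => hx ?_⟩
  rw [D.range_transport_imm γ hγ hγ'] at hmem
  obtain ⟨x', hx', hxx'⟩ := hmem
  rwa [← γ.injective hxx']

/-- A biholomorphism maps the cuspidal torsion points ONTO the cuspidal torsion points.
[cite: MochizukiAbsTopIII2015, Corollary 2.7 (b) p.59] -/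
theorem image_cuspidalTorsionPoints_eq (γ : E ≃ₜ E') (hγ : MDifferentiable 𝓘(ℂ, ℂ) 𝓘(ℂ, ℂ) γ)
    (hγ' : MDifferentiable 𝓘(ℂ, ℂ) 𝓘(ℂ, ℂ) γ.symm) :
    γ '' cuspidalTorsionPoints E = cuspidalTorsionPoints E' := by
  refine Set.Subset.antisymm (image_cuspidalTorsionPoints_subset γ hγ hγ') fun y hy => ?_
  have hγ'' : MDifferentiable 𝓘(ℂ, ℂ) 𝓘(ℂ, ℂ) γ.symm.symm := by rw [γ.symm_symm]; exact hγ
  have h := image_cuspidalTorsionPoints_subset γ.symm hγ' hγ'' ⟨y, hy, rfl⟩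
  exact ⟨γ.symm y, h, γ.apply_symm_apply y⟩

end TwoSpaces

/-- **Sub-node (c).5 `CuspidalTorsionPointsTransport` of the Cor 2.7 sub-DAG — PROVED** (row
Cor-27.c.r15): a biholomorphism of Riemann surfaces carries the cuspidal torsion points onto the cuspidal
torsion points. [cite: MochizukiAbsTopIII2015, Corollary 2.7 (b) p.59] -/
theorem HolomorphicEllipticCuspidalization.cuspidalTorsionPointsTransport_holds :
    Literature.AnabelianGeometry.AbsoluteAnabelian.HolomorphicEllipticCuspidalization.CuspidalTorsionPointsTransport := by
  intro E E' _ _ _ _ _ _ _ _ e he he'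
  exact image_cuspidalTorsionPoints_eq e he he'

end Literature.AnabelianGeometry.AbsoluteAnabelian

end
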